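import Summits.ValiantsHypothesis.ValiantsHypothesis.Theorems.SymPencilPerFourRowForms

/-!
# Route `SymPencil` — points `c` of a hyperplane with `T(·, ·, c)` non-degenerate, for
# `T = per [𝟙; ·; ·; ·]` (tool file for the size-`27` cell `(12,4,2)` of `sdc(per_4)`,
# `--supports` stmt-ValiantsHypothesis-5674; rung currency only, nothing here bears on `VP ≠ VNP`)

Write `T(a, b, c) = per [𝟙; a; b; c] = Σ_{i,k,m distinct} a_i b_k c_m` (the polarised Cayley cubic
`6 e₃` on `K⁴`) and `P(c)` for the symmetric matrix of `T(·, ·, c)` (`P(c)_{ik} = c_m + c_n`,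
`{m, n}` the complementary pair; the Hessian of `e₃` at `c`).

**Theorem** (`exists_injective_point`).  Every hyperplane `ker φ` of `K⁴` (and `K⁴` itself)
contains a point `c` with `P(c)` injective: one of `(t,1,1,1), …, (1,1,1,t)` with `t ≠ -1`
(`injective_point₀…₃`), or, when every non-zero coefficient of `φ` is half their sum
(`φ = 0` or `φ ∝ e_p^* + e_q^*`), one of four explicit `{0, ±1}`-vectors
(`injective_point₀₁, …`).  Used by `SymPencilPerFourBoxNonvanishing` (`per [𝟙; ·]` does not
vanish on a product of three hyperplanes).  Characteristic `0`; no definitions, no named facts.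
[folklore]
-/

noncomputable section

-- single-conjunct layout: Sub = Summit, duplicated namespace component intended
set_option linter.dupNamespace false

namespace Summit.ValiantsHypothesis.ValiantsHypothesis.Theorems.SymPencilPerFourBoxInjective

open Matrix
open Summit.ValiantsHypothesis.ValiantsHypothesis.Theorems.SymPencilPerFourInnerRankRows
open Summit.ValiantsHypothesis.ValiantsHypothesis.Theorems.SymPencilPerFourRowForms

variable {K : Type*} [Field K]

/-! ### Bookkeeping -/

/-- Linearity of `per [𝟙; a; b; c]` in the row `a`, against the coordinate rows. [folklore] -/
theorem per_ones_eq_sum (a b c : Fin 4 → K) :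
    (Matrix.of ![(fun _ => (1 : K)), a, b, c]).permanent =
      ∑ k : Fin 4, a k * (Matrix.of ![(fun _ => (1 : K)), Pi.single k 1, b, c]).permanent := by
  simp [permanent_of_rows, Fin.sum_univ_four]
  ring

/-- Linearity of `per [𝟙; e_k; b; c]` in the row `b`. [folklore] -/
theorem per_ones_single_sub_smul (k : Fin 4) (b b' c : Fin 4 → K) (α β : K) :
    (Matrix.of ![(fun _ => (1 : K)), Pi.single k 1, β • b - α • b', c]).permanent =
      β * (Matrix.of ![(fun _ => (1 : K)), Pi.single k 1, b, c]).permanent -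
        α * (Matrix.of ![(fun _ => (1 : K)), Pi.single k 1, b', c]).permanent := by
  simp only [permanent_of_rows, Pi.sub_apply, Pi.smul_apply, smul_eq_mul]
  ring

/-- A linear form on `K⁴` is the dot product with its coefficient vector. [folklore] -/
theorem apply_eq_dotProduct (φ : (Fin 4 → K) →ₗ[K] K) (a : Fin 4 → K) :
    φ a = (fun k => φ (Pi.single k 1)) ⬝ᵥ a := by
  have ha : a = ∑ k : Fin 4, a k • (Pi.single k (1 : K) : Fin 4 → K) := by
    funext j
    simp [Finset.sum_apply, Pi.single_apply]
  conv_lhs => rw [ha]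
  simp [map_smul, dotProduct, Fin.sum_univ_four, mul_comm]

/-- **Annihilator of a hyperplane**: if `x ⬝ a = 0` whenever `f ⬝ a = 0`, then `x` is a multiple
of `f`. [folklore] -/
theorem exists_smul_of_dotProduct (f x : Fin 4 → K)
    (h : ∀ a : Fin 4 → K, f ⬝ᵥ a = 0 → x ⬝ᵥ a = 0) : ∃ α : K, x = α • f := by
  by_cases hf : f = 0
  · refine ⟨0, ?_⟩
    rw [zero_smul]
    funext k
    have hk := h (Pi.single k 1) (by rw [hf, zero_dotProduct])
    rwa [dotProduct_single, mul_one] at hk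
  · obtain ⟨q, hq⟩ : ∃ q, f q ≠ 0 := by
      by_contra hn
      push Not at hn
      exact hf (funext hn)
    refine ⟨x q / f q, funext fun p => ?_⟩
    have hp := h (f q • Pi.single p 1 - f p • Pi.single q 1) (by
      rw [dotProduct_sub, dotProduct_smul, dotProduct_smul, dotProduct_single, dotProduct_single]
      simp only [smul_eq_mul, mul_one]; ring)
    rw [dotProduct_sub, dotProduct_smul, dotProduct_smul, dotProduct_single, dotProduct_single]
      at hp
    simp only [smul_eq_mul, mul_one] at hp
    rw [Pi.smul_apply, smul_eq_mul]
    field_simp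
    linear_combination hp

/-! ### Points `c` with `P(c)` injective -/

variable [CharZero K]

/-- `P(t, 1, 1, 1)` is injective for `t ≠ -1`. [folklore] -/
theorem injective_point₀ (t : K) (ht : t + 1 ≠ 0) (x : Fin 4 → K)
    (h : ∀ k : Fin 4,
      (Matrix.of ![(fun _ => (1 : K)), Pi.single k 1, x, ![t, 1, 1, 1]]).permanent = 0) :
    x = 0 := by
  have h0 := h 0
  have h1 := h 1
  have h2 := h 2
  have h3 := h 3
  simp [permanent_of_rows] at h0 h1 h2 h3
  have e0 : x 0 = 0 := by linear_combination (h1 + h2 + h3 - (t + 1) * h0) / 6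
  have e23 : x 2 + x 3 = 0 := by
    have : (t + 1) * (x 2 + x 3) = 0 := by linear_combination h1 - 2 * e0
    exact (mul_eq_zero.1 this).resolve_left ht
  have e13 : x 1 + x 3 = 0 := by
    have : (t + 1) * (x 1 + x 3) = 0 := by linear_combination h2 - 2 * e0
    exact (mul_eq_zero.1 this).resolve_left ht
  have e12 : x 1 + x 2 = 0 := by
    have : (t + 1) * (x 1 + x 2) = 0 := by linear_combination h3 - 2 * e0
    exact (mul_eq_zero.1 this).resolve_left ht
  funext k
  fin_cases k
  · exact e0
  · show x 1 = 0; linear_combination (e13 + e12 - e23) / 2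
  · show x 2 = 0; linear_combination (e12 + e23 - e13) / 2
  · show x 3 = 0; linear_combination (e13 + e23 - e12) / 2

/-- `P(1, t, 1, 1)` is injective for `t ≠ -1`. [folklore] -/
theorem injective_point₁ (t : K) (ht : t + 1 ≠ 0) (x : Fin 4 → K)
    (h : ∀ k : Fin 4,
      (Matrix.of ![(fun _ => (1 : K)), Pi.single k 1, x, ![1, t, 1, 1]]).permanent = 0) :
    x = 0 := by
  have h0 := h 0
  have h1 := h 1
  have h2 := h 2
  have h3 := h 3
  simp [permanent_of_rows] at h0 h1 h2 h3
  have e1 : x 1 = 0 := by linear_combination (h0 + h2 + h3 - (t + 1) * h1) / 6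
  have e23 : x 2 + x 3 = 0 := by
    have : (t + 1) * (x 2 + x 3) = 0 := by linear_combination h0 - 2 * e1
    exact (mul_eq_zero.1 this).resolve_left ht
  have e03 : x 0 + x 3 = 0 := by
    have : (t + 1) * (x 0 + x 3) = 0 := by linear_combination h2 - 2 * e1
    exact (mul_eq_zero.1 this).resolve_left ht
  have e02 : x 0 + x 2 = 0 := by
    have : (t + 1) * (x 0 + x 2) = 0 := by linear_combination h3 - 2 * e1
    exact (mul_eq_zero.1 this).resolve_left ht
  funext k
  fin_cases k
  · show x 0 = 0; linear_combination (e03 + e02 - e23) / 2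
  · exact e1
  · show x 2 = 0; linear_combination (e02 + e23 - e03) / 2
  · show x 3 = 0; linear_combination (e03 + e23 - e02) / 2

/-- `P(1, 1, t, 1)` is injective for `t ≠ -1`. [folklore] -/
theorem injective_point₂ (t : K) (ht : t + 1 ≠ 0) (x : Fin 4 → K)
    (h : ∀ k : Fin 4,
      (Matrix.of ![(fun _ => (1 : K)), Pi.single k 1, x, ![1, 1, t, 1]]).permanent = 0) :
    x = 0 := by
  have h0 := h 0
  have h1 := h 1
  have h2 := h 2
  have h3 := h 3
  simp [permanent_of_rows] at h0 h1 h2 h3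
  have e2 : x 2 = 0 := by linear_combination (h0 + h1 + h3 - (t + 1) * h2) / 6
  have e13 : x 1 + x 3 = 0 := by
    have : (t + 1) * (x 1 + x 3) = 0 := by linear_combination h0 - 2 * e2
    exact (mul_eq_zero.1 this).resolve_left ht
  have e03 : x 0 + x 3 = 0 := by
    have : (t + 1) * (x 0 + x 3) = 0 := by linear_combination h1 - 2 * e2
    exact (mul_eq_zero.1 this).resolve_left ht
  have e01 : x 0 + x 1 = 0 := by
    have : (t + 1) * (x 0 + x 1) = 0 := by linear_combination h3 - 2 * e2
    exact (mul_eq_zero.1 this).resolve_left ht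
  funext k
  fin_cases k
  · show x 0 = 0; linear_combination (e03 + e01 - e13) / 2
  · show x 1 = 0; linear_combination (e01 + e13 - e03) / 2
  · exact e2
  · show x 3 = 0; linear_combination (e03 + e13 - e01) / 2

/-- `P(1, 1, 1, t)` is injective for `t ≠ -1`. [folklore] -/
theorem injective_point₃ (t : K) (ht : t + 1 ≠ 0) (x : Fin 4 → K)
    (h : ∀ k : Fin 4,
      (Matrix.of ![(fun _ => (1 : K)), Pi.single k 1, x, ![1, 1, 1, t]]).permanent = 0) :
    x = 0 := by
  have h0 := h 0
  have h1 := h 1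
  have h2 := h 2
  have h3 := h 3
  simp [permanent_of_rows] at h0 h1 h2 h3
  have e3 : x 3 = 0 := by linear_combination (h0 + h1 + h2 - (t + 1) * h3) / 6
  have e12 : x 1 + x 2 = 0 := by
    have : (t + 1) * (x 1 + x 2) = 0 := by linear_combination h0 - 2 * e3
    exact (mul_eq_zero.1 this).resolve_left ht
  have e02 : x 0 + x 2 = 0 := by
    have : (t + 1) * (x 0 + x 2) = 0 := by linear_combination h1 - 2 * e3
    exact (mul_eq_zero.1 this).resolve_left ht
  have e01 : x 0 + x 1 = 0 := by
    have : (t + 1) * (x 0 + x 1) = 0 := by linear_combination h2 - 2 * e3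
    exact (mul_eq_zero.1 this).resolve_left ht
  funext k
  fin_cases k
  · show x 0 = 0; linear_combination (e02 + e01 - e12) / 2
  · show x 1 = 0; linear_combination (e01 + e12 - e02) / 2
  · show x 2 = 0; linear_combination (e02 + e12 - e01) / 2
  · exact e3

/-- `P(1, -1, 1, 0)` is injective. [folklore] -/
theorem injective_point₀₁ (x : Fin 4 → K)
    (h : ∀ k : Fin 4,
      (Matrix.of ![(fun _ => (1 : K)), Pi.single k 1, x, ![1, -1, 1, 0]]).permanent = 0) :
    x = 0 := by
  have h0 := h 0
  have h1 := h 1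
  have h2 := h 2
  have h3 := h 3
  simp [permanent_of_rows] at h0 h1 h2 h3
  funext k
  fin_cases k
  · show x 0 = 0; linear_combination -h2 + h3 / 2
  · show x 1 = 0; linear_combination h3 / 2
  · show x 2 = 0; linear_combination h3 / 2 - h0
  · show x 3 = 0; linear_combination (h1 + h2 + h0 - h3) / 2

/-- `P(0, 1, 1, -1)` is injective. [folklore] -/
theorem injective_point₂₃ (x : Fin 4 → K)
    (h : ∀ k : Fin 4,
      (Matrix.of ![(fun _ => (1 : K)), Pi.single k 1, x, ![0, 1, 1, -1]]).permanent = 0) :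
    x = 0 := by
  have h0 := h 0
  have h1 := h 1
  have h2 := h 2
  have h3 := h 3
  simp [permanent_of_rows] at h0 h1 h2 h3
  funext k
  fin_cases k
  · show x 0 = 0; linear_combination (h3 - h0 + h1 + h2) / 2
  · show x 1 = 0; linear_combination -h2 + h0 / 2
  · show x 2 = 0; linear_combination -h1 + h0 / 2
  · show x 3 = 0; linear_combination h0 / 2

/-- `P(1, 1, -1, 0)` is injective. [folklore] -/
theorem injective_point₀₂ (x : Fin 4 → K)
    (h : ∀ k : Fin 4,
      (Matrix.of ![(fun _ => (1 : K)), Pi.single k 1, x, ![1, 1, -1, 0]]).permanent = 0) :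
    x = 0 := by
  have h0 := h 0
  have h1 := h 1
  have h2 := h 2
  have h3 := h 3
  simp [permanent_of_rows] at h0 h1 h2 h3
  funext k
  fin_cases k
  · show x 0 = 0; linear_combination h3 / 2 - h1
  · show x 1 = 0; linear_combination h3 / 2 - h0
  · show x 2 = 0; linear_combination h3 / 2
  · show x 3 = 0; linear_combination (h2 - h3 + h1 + h0) / 2

/-- `P(1, 1, 0, -1)` is injective. [folklore] -/
theorem injective_point₀₃ (x : Fin 4 → K)
    (h : ∀ k : Fin 4,
      (Matrix.of ![(fun _ => (1 : K)), Pi.single k 1, x, ![1, 1, 0, -1]]).permanent = 0) :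
    x = 0 := by
  have h0 := h 0
  have h1 := h 1
  have h2 := h 2
  have h3 := h 3
  simp [permanent_of_rows] at h0 h1 h2 h3
  funext k
  fin_cases k
  · show x 0 = 0; linear_combination h2 / 2 - h1
  · show x 1 = 0; linear_combination h2 / 2 - h0
  · show x 2 = 0; linear_combination (h3 - h2 + h1 + h0) / 2
  · show x 3 = 0; linear_combination h2 / 2

/-- **Every hyperplane (and `K⁴`) contains a point `c` with `P(c)` injective.** [folklore] -/
theorem exists_injective_point (φ : (Fin 4 → K) →ₗ[K] K) :
    ∃ c : Fin 4 → K, φ c = 0 ∧ ∀ x : Fin 4 → K,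
      (∀ k : Fin 4, (Matrix.of ![(fun _ => (1 : K)), Pi.single k 1, x, c]).permanent = 0) →
        x = 0 := by
  set f : Fin 4 → K := fun k => φ (Pi.single k 1) with hf
  have hφ : ∀ c : Fin 4 → K, φ c = f 0 * c 0 + f 1 * c 1 + f 2 * c 2 + f 3 * c 3 := fun c => by
    rw [apply_eq_dotProduct, dotProduct, Fin.sum_univ_four]
  -- the four one-parameter candidates `(…, t, …)`, `t = (f_i - Σ f) / f_i ≠ -1`
  by_cases hA : f 0 ≠ 0 ∧ f 0 + f 1 + f 2 + f 3 ≠ 2 * f 0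
  · refine ⟨![(f 0 - (f 0 + f 1 + f 2 + f 3)) / f 0, 1, 1, 1], ?_,
      fun x hx => injective_point₀ _ ?_ x hx⟩
    · have h0 := hA.1
      rw [hφ]; simp; field_simp; ring
    · intro h
      apply hA.2
      have h0 := hA.1
      field_simp at h
      linear_combination -h
  by_cases hB : f 1 ≠ 0 ∧ f 0 + f 1 + f 2 + f 3 ≠ 2 * f 1
  · refine ⟨![1, (f 1 - (f 0 + f 1 + f 2 + f 3)) / f 1, 1, 1], ?_,
      fun x hx => injective_point₁ _ ?_ x hx⟩
    · have h0 := hB.1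
      rw [hφ]; simp; field_simp; ring
    · intro h
      apply hB.2
      have h0 := hB.1
      field_simp at h
      linear_combination -h
  by_cases hC : f 2 ≠ 0 ∧ f 0 + f 1 + f 2 + f 3 ≠ 2 * f 2
  · refine ⟨![1, 1, (f 2 - (f 0 + f 1 + f 2 + f 3)) / f 2, 1], ?_,
      fun x hx => injective_point₂ _ ?_ x hx⟩
    · have h0 := hC.1
      rw [hφ]; simp; field_simp; ring
    · intro h
      apply hC.2
      have h0 := hC.1
      field_simp at h
      linear_combination -h
  by_cases hD : f 3 ≠ 0 ∧ f 0 + f 1 + f 2 + f 3 ≠ 2 * f 3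
  · refine ⟨![1, 1, 1, (f 3 - (f 0 + f 1 + f 2 + f 3)) / f 3], ?_,
      fun x hx => injective_point₃ _ ?_ x hx⟩
    · have h0 := hD.1
      rw [hφ]; simp; field_simp; ring
    · intro h
      apply hD.2
      have h0 := hD.1
      field_simp at h
      linear_combination -h
  -- otherwise every coefficient is `0` or half the sum: `φ = 0` or `φ ∝ e_p^* + e_q^*`
  rw [not_and_or, not_not, not_not] at hA hB hC hD
  have hA' : f 0 = 0 ∨ f 0 = (f 0 + f 1 + f 2 + f 3) / 2 :=
    hA.imp id fun h => by linear_combination -h / 2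
  have hB' : f 1 = 0 ∨ f 1 = (f 0 + f 1 + f 2 + f 3) / 2 :=
    hB.imp id fun h => by linear_combination -h / 2
  have hC' : f 2 = 0 ∨ f 2 = (f 0 + f 1 + f 2 + f 3) / 2 :=
    hC.imp id fun h => by linear_combination -h / 2
  have hD' : f 3 = 0 ∨ f 3 = (f 0 + f 1 + f 2 + f 3) / 2 :=
    hD.imp id fun h => by linear_combination -h / 2
  rcases hA' with a0 | a0 <;> rcases hB' with a1 | a1 <;> rcases hC' with a2 | a2 <;>
    rcases hD' with a3 | a3
  all_goals first
    | exact ⟨![0, 1, 1, -1], by rw [hφ]; simp; linear_combination a1 + a2 - a3,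
        fun x hx => injective_point₂₃ x hx⟩
    | exact ⟨![1, -1, 1, 0], by rw [hφ]; simp; linear_combination a0 - a1 + a2,
        fun x hx => injective_point₀₁ x hx⟩
    | exact ⟨![1, -1, 1, 0], by
        rw [hφ]; simp; linear_combination a0 - a1 + a2 + (-1 / 2) * (a0 + a1 + a2 + a3),
        fun x hx => injective_point₀₁ x hx⟩
    | exact ⟨![1, -1, 1, 0], by
        rw [hφ]; simp; linear_combination a0 - a1 + a2 + (-1) * (a0 + a1 + a2 + a3),
        fun x hx => injective_point₀₁ x hx⟩
    | exact ⟨![1, -1, 1, 0], by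
        rw [hφ]; simp; linear_combination a0 - a1 + a2 + (-2) * (a0 + a1 + a2 + a3),
        fun x hx => injective_point₀₁ x hx⟩
    | exact ⟨![1, -1, 1, 0], by
        rw [hφ]; simp; linear_combination a0 - a1 + a2 + (a0 + a1 + a2 + a3),
        fun x hx => injective_point₀₁ x hx⟩
    | exact ⟨![1, 1, -1, 0], by rw [hφ]; simp; linear_combination a0 + a1 - a2,
        fun x hx => injective_point₀₂ x hx⟩
    | exact ⟨![1, 1, 0, -1], by rw [hφ]; simp; linear_combination a0 + a1 - a3,
        fun x hx => injective_point₀₃ x hx⟩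

end Summit.ValiantsHypothesis.ValiantsHypothesis.Theorems.SymPencilPerFourBoxInjective

end
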